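import Summits.BirchSwinnertonDyer.BirchSwinnertonDyer.Theorems.KolyvaginRoadThreeZhangInductionOnPos
import HarnessLib

/-!
# Route `KolyvaginRoadThree`, deciding crux `ZhangSharpFrameAtThreeHL` (item stmt-BirchSwinnertonDyer-19574):
# W. Zhang's induction on good levels with BOTH refinements at once — triangulation (A3) only at NON-EMPTY levels,
# congruence transport (A2) only at EVEN levels, and parity only at the STARTING level
# (cell `bsd-stepL`, OWNER seat `bsd-stepL-koly` g14; `--supports stmt-BirchSwinnertonDyer-19574`, helper; the
# composition engine of the reshaped METHOD skeleton v2z, whose S2 is cut over the R-c objects)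

HONEST FRAMING. Pure linear algebra over an arbitrary field `F`; nothing about elliptic curves, Heegner points,
level raising or `p = 3` is asserted; every number-theoretic input is an explicitly named HYPOTHESIS SHAPE; 0
definitions, 0 named facts, 0 `sorry`. PARTITION: O2@3 (B10) × A1 × crux 19574 — none (composition engine; types
nothing, closes nothing; T7).

WHY. The tree holds two refinements of zhang3-p1's relativised engine
`ZhangInductionOn.exists_ne_zero_of_zhangInduction_on` (p455609): koly3b's
`ZhangInductionOnPos.exists_ne_zero_of_zhangInduction_on_pos` (p471131: (A3) carries `n.Nonempty` — Lemma 8.4 is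
applied only to the level-raised system `κ_{q₁q₂}`, never at the bottom) and koly3a's
`ZhangInduction.exists_ne_zero_of_zhangInduction_on_oddStart` (parity (A6) only at the starting level — the rank
drops by exactly two along the descent). The reshaped skeleton v2z of crux 19574 needs BOTH at once: its stub T
(`stub_triangulationAtThree`, Lemma 8.4 for abstract mod-3 Kolyvagin systems) is asked only at non-empty good even
levels, where the classes are the R-c level-raised classes, and its stub P (`stub_oddSelmerRankAtThree`) gives the
3-parity of `Sel₃(E/K)` at the bottom only. This file is that merge — `exists_ne_zero_of_zhangInduction_on_pos_oddStart`
— with one more harmless relaxation read off the printed proof: (A2) (Thm. 4.3, contrapositive form) and (A4) are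
invoked only FROM an EVEN level `n` (to `n ∪ {q₁, q₂}`), so (A2) carries the binder `Even n.card` (the skeleton's
tower stub states Thm. 4.3 between indefinite levels only). Proof = zhang3-p1's ∕ koly3a's ∕ koly3b's, merged
verbatim: strong induction on the total rank `k` with `Odd k` carried along, two rank-lowering steps inside the
larger eigenspace, induction hypothesis at the non-empty even level `n ∪ {q₁, q₂}` (odd rank `k − 2`), transport by
(A2) unless `q₂` is a base point, which (A3) at `n ∪ {q₁, q₂}` + (A4) exclude by Zhang's cases (9.3)–(9.4).

References: [cite: WZhang2014, §9 proof of Thm. 9.1 (pp. 240–242), Thm. 9.2, Lemma 8.4, Prop. 5.4, Thm. 4.3, Thm. 7.2].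
-/

namespace Summit.BirchSwinnertonDyer.Rank1Residual.X11b.Three.Koly.ZhangInductionOnPosOddStart

open Module

variable {F : Type*} [Field F] {H : Type*} [AddCommGroup H] [Module F H]
  {Q : Type*} [DecidableEq Q] {M : Type*}

/-- A submodule of positive dimension has a non-zero element. [folklore] -/
private theorem exists_mem_ne_zero_of_finrank_pos {S : Submodule F H} (h : 0 < finrank F S) :
    ∃ c ∈ S, c ≠ 0 := by
  by_contra hc
  push Not at hc
  have hbot : S = ⊥ := (Submodule.eq_bot_iff S).mpr hc
  rw [hbot, finrank_bot] at h
  exact lt_irrefl 0 h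

omit [DecidableEq Q] in
/-- The total rank does not depend on which eigenspace is listed first. [folklore] -/
private theorem rank_symm (Sel : Finset Q → Bool → Submodule F H) (n : Finset Q) (μ : Bool) :
    finrank F (Sel n μ) + finrank F (Sel n (!μ)) = finrank F (Sel n true) + finrank F (Sel n false) := by
  cases μ
  · rw [Bool.not_false, add_comm]
  · rw [Bool.not_true]

set_option maxHeartbeats 400000 in
/-- **W. Zhang's induction on GOOD levels — (A3) only at NON-EMPTY even levels, (A2)∕(A5) only at EVEN levels,
parity only at the STARTING level** (Camb. J. Math. 2 (2014), proof of Thm. 9.1, relativised and refined). Data: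
a predicate `Good` on levels (finite sets of admissible primes), eigen-Selmer spaces `Sel n ±`, relaxed spaces
`SelRel n S ±`, a base locus `B n`, classes `κ m n`, a bottom index `m₁`. Hypotheses: (A1) rank lowering at a fresh
prime staying inside the good levels with the eigen-bookkeeping (9.1)–(9.2) [Prop. 5.4 + Lemma 7.3]; (A2) transport
of non-vanishing from `n ∪ {q₁, q₂}` down to the EVEN good level `n` unless `q₂` is a base point of the upper system
[Thm. 4.3]; (A3) the triangulation at good even levels OF POSITIVE CARDINALITY carrying a non-zero class
[Lemma 8.4 (1)+(3)]; (A4) relaxation along one good step [(9.3), definitional]; (A5) the base case at good even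
levels of total rank one [Thm. 7.2]. Conclusion: at every GOOD EVEN level `n₀` of ODD total rank some class
`κ m n₀` is non-zero — no parity or non-vanishing hypothesis at any other level (the rank drops by exactly two along
the descent and the levels reached stay good by (A1)), and no triangulation at the bottom. CONDITIONAL on every
binder; uniform in `F`; nothing is booked. [cite: WZhang2014, §9 proof of Thm. 9.1 and Thm. 9.2] -/
theorem exists_ne_zero_of_zhangInduction_on_pos_oddStart (Good : Finset Q → Prop)
    (Sel : Finset Q → Bool → Submodule F H) (SelRel : Finset Q → Set Q → Bool → Submodule F H)
    (B : Finset Q → Set Q) (κ : M → Finset Q → H) (m₁ : M)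
    -- (A1) rank lowering at a fresh prime, staying inside the good levels, eigen-bookkeeping (9.1)–(9.2)
    (hA1 : ∀ (n : Finset Q) (μ : Bool) (c : H), Good n → c ∈ Sel n μ → c ≠ 0 →
      ∃ q, q ∉ n ∧ Good (insert q n) ∧ c ∉ Sel (insert q n) μ ∧ Sel (insert q n) μ ≤ Sel n μ ∧
        finrank F (Sel (insert q n) μ) + 1 = finrank F (Sel n μ) ∧ Sel (insert q n) (!μ) = Sel n (!μ))
    -- (A2) cohomological congruence, contrapositive form, from an EVEN good level along two good steps
    (hA2 : ∀ (n : Finset Q) (q₁ q₂ : Q), Good n → Even n.card → Good (insert q₁ n) →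
      Good (insert q₂ (insert q₁ n)) → q₁ ∉ n → q₂ ∉ insert q₁ n → q₂ ∉ B (insert q₂ (insert q₁ n)) →
      ∃ m, κ m n ≠ 0)
    -- (A3) triangulation at a good even level OF POSITIVE CARDINALITY carrying a non-zero class
    (hA3 : ∀ (n : Finset Q), Good n → n.Nonempty → Even n.card → (∃ m, κ m n ≠ 0) →
      ∃ (s : Bool) (d : ℕ), finrank F (Sel n s) = d + 1 ∧ Sel n s = SelRel n (B n) s ∧
        FiniteDimensional F (SelRel n (B n) (!s)) ∧ finrank F (SelRel n (B n) (!s)) ≤ d)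
    -- (A4) relaxation: good levels n and n ∪ {q} differ only at q
    (hA4 : ∀ (n : Finset Q) (q : Q) (S : Set Q) (s : Bool), Good n → Good (insert q n) → q ∉ n → q ∈ S →
      Sel n s ≤ SelRel (insert q n) S s)
    -- (A5) base case at good even levels: total rank one
    (hA5 : ∀ (n : Finset Q), Good n → Even n.card →
      finrank F (Sel n true) + finrank F (Sel n false) = 1 → κ m₁ n ≠ 0) :
    ∀ (n : Finset Q), Good n → Even n.card → Odd (finrank F (Sel n true) + finrank F (Sel n false)) →
      ∃ m, κ m n ≠ 0 := by
  suffices hmain : ∀ (k : ℕ) (n : Finset Q), Good n → finrank F (Sel n true) + finrank F (Sel n false) = k →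
      Even n.card → Odd k → ∃ m, κ m n ≠ 0 from fun n hg hn hodd ↦ hmain _ n hg rfl hn hodd
  intro k
  induction k using Nat.strong_induction_on with
  | _ k ih =>
    intro n hg hk hn hodd
    by_cases h1 : finrank F (Sel n true) + finrank F (Sel n false) = 1
    · exact ⟨m₁, hA5 n hg hn h1⟩
    have h3 : 3 ≤ finrank F (Sel n true) + finrank F (Sel n false) := by
      obtain ⟨t, ht⟩ := hodd
      omega
    obtain ⟨μ, hμ⟩ : ∃ μ : Bool, finrank F (Sel n (!μ)) < finrank F (Sel n μ) := by
      by_cases hlt : finrank F (Sel n false) < finrank F (Sel n true)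
      · exact ⟨true, by rw [Bool.not_true]; exact hlt⟩
      · refine ⟨false, ?_⟩
        have hne : finrank F (Sel n true) ≠ finrank F (Sel n false) := by
          intro heq
          obtain ⟨t, ht⟩ := hodd
          omega
        rw [Bool.not_false]
        omega
    have hsum := rank_symm Sel n μ
    have hμ2 : 2 ≤ finrank F (Sel n μ) := by omega
    -- first rank lowering, at q₁ (the new level is good)
    obtain ⟨c₁, hc₁, hc₁0⟩ := exists_mem_ne_zero_of_finrank_pos (S := Sel n μ) (by omega)
    obtain ⟨q₁, hq₁n, hg₁, -, -, hrk₁, hneg₁⟩ := hA1 n μ c₁ hg hc₁ hc₁0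
    -- second rank lowering, at q₂, killing a non-zero c₂ ∈ Sel (n ∪ {q₁}) μ (the new level is good)
    obtain ⟨c₂, hc₂, hc₂0⟩ := exists_mem_ne_zero_of_finrank_pos (S := Sel (insert q₁ n) μ) (by omega)
    obtain ⟨q₂, hq₂n, hg₂, hc₂out, hle₂, hrk₂, hneg₂⟩ := hA1 (insert q₁ n) μ c₂ hg₁ hc₂ hc₂0
    set n₁ := insert q₁ n with hn₁
    set n₂ := insert q₂ n₁ with hn₂
    have hne₂ : n₂.Nonempty := Finset.insert_nonempty q₂ n₁
    have hcard : n₂.card = n.card + 2 := by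
      rw [hn₂, Finset.card_insert_of_notMem hq₂n, hn₁, Finset.card_insert_of_notMem hq₁n]
    have hn₂even : Even n₂.card := by
      obtain ⟨t, ht⟩ := hn
      exact ⟨t + 1, by rw [hcard]; omega⟩
    have hsum₂ := rank_symm Sel n₂ μ
    have hrank₂ : finrank F (Sel n₂ true) + finrank F (Sel n₂ false) + 2 = k := by
      rw [← hsum₂, hneg₂, hneg₁, ← hk, ← hsum]
      omega
    have hodd₂ : Odd (finrank F (Sel n₂ true) + finrank F (Sel n₂ false)) := by
      obtain ⟨t, ht⟩ := hodd
      exact ⟨t - 1, by omega⟩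
    -- induction hypothesis at the NON-EMPTY even level n₂ (odd rank k − 2)
    obtain ⟨m', hm'⟩ := ih _ (by omega) n₂ hg₂ rfl hn₂even hodd₂
    -- transport down by (A2) (from the EVEN level n) unless q₂ is a base point of the level-n₂ system
    refine hA2 n q₁ q₂ hg hn hg₁ hg₂ hq₁n hq₂n fun hq₂B ↦ ?_
    -- (A3) is used HERE ONLY: at the non-empty even level n₂
    obtain ⟨s, d, hs1, hs2, hs3fin, hs3⟩ := hA3 n₂ hg₂ hne₂ hn₂even ⟨m', hm'⟩
    by_cases hsμ : s = μ
    · -- case (1): the killed class c₂ would lie in Sel n₂ μ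
      subst hsμ
      have hincl : Sel n₁ s ≤ SelRel n₂ (B n₂) s := hA4 n₁ q₂ (B n₂) s hg₁ hg₂ hq₂n hq₂B
      exact hc₂out (hs2 ▸ hincl hc₂)
    · -- case (2): dimension count (9.1)–(9.4)
      have hs : s = !μ := by cases s <;> cases μ <;> simp_all
      subst hs
      have hincl : Sel n₁ μ ≤ SelRel n₂ (B n₂) μ := hA4 n₁ q₂ (B n₂) μ hg₁ hg₂ hq₂n hq₂B
      haveI : FiniteDimensional F (SelRel n₂ (B n₂) μ) := by
        rw [Bool.not_not] at hs3fin
        exact hs3fin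
      have hle : finrank F (Sel n₁ μ) ≤ finrank F (SelRel n₂ (B n₂) μ) := Submodule.finrank_mono hincl
      have hs3' : finrank F (SelRel n₂ (B n₂) μ) ≤ d := by rw [Bool.not_not] at hs3; exact hs3
      rw [hneg₂, hneg₁] at hs1
      omega

/-- **At the bottom level** `∅` (assumed good, even by `card ∅ = 0`): (A1), (A2) at even levels, (A3) at non-empty
even levels, (A4), (A5) at even levels, and ODD total rank at `∅` ALONE give a non-zero bottom class `κ m ∅` —
Zhang's Thm. 9.1 `κ ≠ 0` in the shape the reshaped skeleton v2z of crux 19574 consumes.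
[cite: WZhang2014, Thm. 9.1 and Thm. 9.2] -/
theorem exists_ne_zero_at_bottom_of_zhangInduction_on_pos_oddStart (Good : Finset Q → Prop) (hgood : Good ∅)
    (Sel : Finset Q → Bool → Submodule F H) (SelRel : Finset Q → Set Q → Bool → Submodule F H)
    (B : Finset Q → Set Q) (κ : M → Finset Q → H) (m₁ : M)
    (hA1 : ∀ (n : Finset Q) (μ : Bool) (c : H), Good n → c ∈ Sel n μ → c ≠ 0 →
      ∃ q, q ∉ n ∧ Good (insert q n) ∧ c ∉ Sel (insert q n) μ ∧ Sel (insert q n) μ ≤ Sel n μ ∧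
        finrank F (Sel (insert q n) μ) + 1 = finrank F (Sel n μ) ∧ Sel (insert q n) (!μ) = Sel n (!μ))
    (hA2 : ∀ (n : Finset Q) (q₁ q₂ : Q), Good n → Even n.card → Good (insert q₁ n) →
      Good (insert q₂ (insert q₁ n)) → q₁ ∉ n → q₂ ∉ insert q₁ n → q₂ ∉ B (insert q₂ (insert q₁ n)) →
      ∃ m, κ m n ≠ 0)
    (hA3 : ∀ (n : Finset Q), Good n → n.Nonempty → Even n.card → (∃ m, κ m n ≠ 0) →
      ∃ (s : Bool) (d : ℕ), finrank F (Sel n s) = d + 1 ∧ Sel n s = SelRel n (B n) s ∧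
        FiniteDimensional F (SelRel n (B n) (!s)) ∧ finrank F (SelRel n (B n) (!s)) ≤ d)
    (hA4 : ∀ (n : Finset Q) (q : Q) (S : Set Q) (s : Bool), Good n → Good (insert q n) → q ∉ n → q ∈ S →
      Sel n s ≤ SelRel (insert q n) S s)
    (hA5 : ∀ (n : Finset Q), Good n → Even n.card →
      finrank F (Sel n true) + finrank F (Sel n false) = 1 → κ m₁ n ≠ 0)
    (hodd : Odd (finrank F (Sel ∅ true) + finrank F (Sel ∅ false))) :
    ∃ m, κ m ∅ ≠ 0 :=
  exists_ne_zero_of_zhangInduction_on_pos_oddStart Good Sel SelRel B κ m₁ hA1 hA2 hA3 hA4 hA5 ∅ hgood (by simp) hodd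

end Summit.BirchSwinnertonDyer.Rank1Residual.X11b.Three.Koly.ZhangInductionOnPosOddStart
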